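import Literature.MathematicalPhysics.QuantumFieldTheory.King1986.MinimizerTwoSpacingHolder
import HarnessLib

/-!
# King 1986, Proposition 3.8 (3.71), THIRD AND FOURTH LINES IN THEIR PRINTED SHAPE `≦ CL^{−γk}exp[−δ₀dist({x, y}, z)]`
# for the ACTUAL minimiser kernels: the Hölder-quotient DECAY of `a_kG^η_kQ^*_k` and of `a_k∂^η_μG^η_kQ^*_k` (Theorem 3.3
# (3.8) ∕ Prop. 3.7 (3.65) for these operators, derived on the torus from the sup clauses and the momentum-space
# Lipschitz ∕ Hölder-`s` bounds) and «combining with Theorem 3.3»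

**Citation header (reproduction of PUBLISHED and PROVED work; seat `pub-ymgap-dag-n18-b` (g2) of the cell `pub-ymgap`,
Track-A node N18 = NE5 whose PRINTED MODEL of record is King's Prop. 3.8 ∕ 3.9; thirteenth file of the seat's chain — the
decay factors that `MinimizerTwoSpacingHolder` (sup-norm rates of lines 3–4) lists as NOT COVERED.)**
C. King, *The U(1) Higgs model. I. The continuum limit*, Commun. Math. Phys. **102** (1986) 649–677 [King1986]: Theorem 3.3
(3.8) p. 658 (Hölder bounds of `G_k(Ω, A)`, «see [Ba 4]»), (3.62) p. 663, Prop. 3.7 (3.65) p. 663, Prop. 3.8 (3.71) p. 664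
(third line, right-hand side `CL^{−γk}exp[−δ₀dist({x, y}, z)]`), p. 674 «combining our bounds with Theorem 3.3 we deduce
(3.71)».  T. Bałaban, *Regularity and decay of lattice Green's functions*, CMP **89** (1983) [Balaban1983RegularityDecay],
Theorem (1.10) p. 573.  King's paper is TEMPLATE LITERATURE (printed and proved `A = 0` mechanism); nothing here is about
Bałaban's covariant objects.

**What this file PROVES (kernel; 0 `def`).**  With `ρ = |x − y|` the sup torus distance in unit coordinates (`holdist`),
`ℋ_k = minimiser N M a_k N² m²` the ACTUAL operator, `B(x)` the unit block under `x`: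
* §1 `abs_le_of_factor_digitSum` — the uniform bound of ANY factored digit sum (4.19) whose extra factor has size
  `‖E(Q)‖ ≤ c_E‖Q‖^β`, `0 ≤ β < 2` (the pattern of `MinimizerTwoSpacing.abs_minimiser_kernel_le_unif`, = the case `E = 1`).
* §2 **`abs_holderOne_kernel_le_unif`** — the LIPSCHITZ bound `|ρ⁻¹(ℋ_k(x, b) − ℋ_k(y, b))| ≤ C_Lip` uniformly in `N`,
  the torus, the mass and the points (§1 at `E = holderFac 1 ρ u`, `β = 1`, `c_E = 2d`): the Hölder quotient at
  exponent `1` is bounded, a momentum-space fact ((4.22) at `α = 1` would diverge; at `α = 1` WITHOUT the `L^{−γk}`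
  extraction the alias exponent is `0` and (4.22) converges).
* §3 **`holder_kernel_decay_blocks`** — THEOREM 3.3 (3.8) ∕ PROP. 3.7 (3.65) FOR `ℋ_K` ON BAŁABAN'S VOLUMES: for
  `0 < α < 1` there are `δ, c > 0` (functions of `d, L, a, m², α`) with `|ρ^{−α}(ℋ_K(x, b) − ℋ_K(y, b))| ≤ a_K⁰·c·
  exp(−δ·min(|B(x) − b|, |B(y) − b|))` for every volume, every `x, y, b` — by INTERPOLATION between §2 (`≤ C_Lipρ`) and
  the sup decay `minimiser_kernel_decay_blocks` (`|ℋ(x)| + |ℋ(y)| ≤ 2ac₀e^{−δ₀min}`) with weights `α, 1 − α` when `ρ ≤ 1`,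
  and the sup decay alone when `ρ > 1`; `δ = (1 − α)δ₀`.  (King quotes (3.8) from [Ba 4]; the tree's transport of [Ba 4]
  (`thm110_zero_torus`) carries the sup and derivative clauses, and this interpolation recovers the Hölder clause for the
  kernel from the sup clause; §5 does the same for the derivative from the derivative clause.)
* §4 **`king_prop38_holder_torus_blocks`** — (3.71) LINE 3 IN ITS PRINTED SHAPE, UNCONDITIONAL: `|(∂_α(x′,y′)ℋ_{K+n})(b) −
  (∂_α(x,y)ℋ_K)(b)| ≤ √(2c(C₁ + C₂)L^{−γK})·exp(−(δ∕2)·min(|B(x) − b|, |B(y) − b|))` — King's `CL^{−γ′k}exp[−δ₀′dist({x,y}, z)]`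
  with `γ′ = γ∕2`, `δ₀′ = (1 − α)δ₀∕2` (the sup rate `king_prop38_holder_torus` interpolated with §3 for both runs, whose
  blocks agree: `blockOf_over`).
* §5 **`abs_holderS_dkernel_le_unif`** (the lattice DERIVATIVE is Hölder-`s` in the fine point for every `s < 1`, uniformly
  in `η`: §1 at `β = 1 + s`) and **`holder_dkernel_decay_blocks`** (the Hölder quotient of `∂^η_μℋ_K` decays: interpolation
  at `s = (1 + α)∕2` with weight `t = α∕s` against the derivative sup clause `dminimiser_kernel_decay_blocks`; rate
  `(1 − t)δ₀ = (1 − α)∕(1 + α)·δ₀`); §6 **`king_prop38_holder_deriv_torus_blocks`** — (3.71) LINE 4 IN ITS PRINTED SHAPE,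
  UNCONDITIONAL (`α + γ < 1`).  With this file ALL FOUR LINES of (3.71) are tree theorems for the actual operators in their
  printed shape (sup rate × exponential factor), on Bałaban's volumes.

**NOT COVERED.**  Unit tori other than `2L^m` for the decay; Euclidean in place of sup distances; even `L`; `A ≠ 0`.  HONEST FRAMING: King's `A = 0` scalar MODEL of the NE5 mechanism — template
literature on a finite torus; nothing about Bałaban's covariant objects; nothing continuum ∕ mass-gap ∕ Clay; count-neutral
for the cell's 27 nodes.
-/

noncomputable section

open Finset Real Matrix
open scoped BigOperators ComplexConjugate

namespace Literature.MathematicalPhysics.QuantumFieldTheory.King1986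

open Literature.MathematicalPhysics.QuantumFieldTheory.Balaban1983to89 (Params)
open Literature.MathematicalPhysics.QuantumFieldTheory.Balaban1983to89.B5Prop11Plancherel

namespace Torus

variable {d : ℕ}

/-! ## §1 The uniform bound of a factored digit sum -/

/-- **UNIFORM BOUND OF A FACTORED DIGIT SUM** — the `E`-weighted form of `abs_minimiser_kernel_le_unif`: if a real `F` is
the average over the reduced momenta of King's alias sums (4.19) of the modes `Δ^{(k)}u^ηΔ^{η−1}e^{iQ·ξ}·E(Q)` (odd `N`,
King's symbol `Δ^{(k)} = DeltaEff a N`) and `‖E(Q)‖ ≤ c_E‖Q‖^β` at the alias momenta (`0 ≤ β < 2`), then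
`|F| ≤ (π/2)^d·[(π²/4)^{d+1}·c_Eπ^β + a(π²/4)c_E·C(d, β−1)]` — central alias by (4.21) at `l = 0`, the others by
(4.20)–(4.22). [cite: King1986, (4.2) p.670, (4.19)–(4.22) p.672] -/
theorem abs_le_of_factor_digitSum (hd : 0 < d) {N : ℕ} [NeZero N] (hN : Odd N) (hN1 : 1 ≤ N)
    (M : Fin d → ℕ) [hM : ∀ μ, NeZero (M μ)] {a m2 : ℝ} (ha : 0 < a) (hm : 0 < m2) (b : Tor M)
    {β : ℝ} (hβ : 0 ≤ β) (hβ2 : β < 2) (ξ : Fin d → ℝ) (E : (Fin d → ℝ) → ℂ) {cE : ℝ} (hcE : 0 ≤ cE)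
    (hE : ∀ (q : Tor M) (w : Fin d → ℤ), ‖E (aliasPt (sOf M q) w)‖ ≤ cE * ‖aliasPt (sOf M q) w‖ ^ β)
    {F : ℝ}
    (hA : ((F : ℝ) : ℂ) = (Fintype.card (Tor M) : ℂ)⁻¹ * ∑ q : Tor M, conj (chi M q b)
      * ∑ w ∈ digitBox d N, fmodeTerm (DeltaEff a N m2 (sOf M q)) (N : ℝ)⁻¹ m2 (aliasPt (sOf M q) w) ξ E) :
    |F| ≤ (π / 2) ^ d * ((π ^ 2 / 4) ^ d * (π ^ 2 / 4) * (cE * π ^ β) + a * (π ^ 2 / 4) * cE * aliasConst d (β - 1)) := by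
  have hNr : (0 : ℝ) < N := by exact_mod_cast (show 0 < N by omega)
  have hη : (0 : ℝ) < (N : ℝ)⁻¹ := inv_pos.mpr hNr
  have hcard : (Fintype.card (Tor M) : ℝ) ≠ 0 := by exact_mod_cast Fintype.card_ne_zero
  set Bd : ℝ := (π / 2) ^ d * ((π ^ 2 / 4) ^ d * (π ^ 2 / 4) * (cE * π ^ β)
      + a * (π ^ 2 / 4) * cE * aliasConst d (β - 1)) with hBd
  -- per reduced momentum
  have hq : ∀ q : Tor M,
      ‖∑ w ∈ digitBox d N, fmodeTerm (DeltaEff a N m2 (sOf M q)) (N : ℝ)⁻¹ m2 (aliasPt (sOf M q) w) ξ E‖ ≤ Bd := by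
    intro q
    have hp : ∀ μ, |sOf M q μ| ≤ π := abs_sOf_le M q
    have hΔ0 : 0 ≤ DeltaEff a N m2 (sOf M q) := DeltaEff_nonneg ha.le N hm.le _
    have hΔa : DeltaEff a N m2 (sOf M q) ≤ a := DeltaEff_le ha N hm.le _
    have hzone : ∀ j ∈ digitBox d N, ∀ μ, |(N : ℝ)⁻¹ * aliasPt (sOf M q) j μ| ≤ π := by
      intro j hj μ
      rw [abs_mul, abs_of_pos hη, inv_mul_le_iff₀ hNr, mul_comm]
      exact zoneA_of_digit hp (two_abs_lt_of_mem_digitBox N hN hj) μ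
    rw [← Finset.add_sum_erase _ _ (zero_mem_digitBox d N)]
    refine (norm_add_le _ _).trans ?_
    -- central digit
    have hcentral : ‖fmodeTerm (DeltaEff a N m2 (sOf M q)) (N : ℝ)⁻¹ m2 (aliasPt (sOf M q) 0) ξ E‖
        ≤ (π / 2) ^ d * ((π ^ 2 / 4) ^ d * (π ^ 2 / 4) * (cE * π ^ β)) := by
      have hE0 := hE q 0
      have h0 : aliasPt (sOf M q) 0 = sOf M q := by funext μ; simp [aliasPt]
      rw [norm_fmodeTerm hΔ0 hm.le, modeAmp, h0]
      rw [h0] at hE0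
      have hz : ∀ μ, |(N : ℝ)⁻¹ * sOf M q μ| ≤ π := fun μ => by
        have := hzone 0 (zero_mem_digitBox d N) μ; rwa [h0] at this
      have hcen := DeltaEff_le_mul_latticeSymbol_of_mass ha hN1 hm hp
      have hr := central_ratio_le (ne_of_gt hη) (ne_of_gt hη) hm.le (by positivity) hz hcen
      have hpπ : ‖sOf M q‖ ≤ π := (pi_norm_le_iff_of_nonneg Real.pi_pos.le).mpr fun μ => by
        rw [Real.norm_eq_abs]; exact hp μ
      have hE0' : ‖E (sOf M q)‖ ≤ cE * π ^ β :=
        hE0.trans (mul_le_mul_of_nonneg_left (Real.rpow_le_rpow (norm_nonneg _) hpπ hβ) hcE)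
      calc DeltaEff a N m2 (sOf M q) * (latticeSymbol (N : ℝ)⁻¹ m2 (sOf M q))⁻¹ * ‖uWeight (N : ℝ)⁻¹ (sOf M q)‖
            * ‖E (sOf M q)‖
          ≤ ((π ^ 2 / 4) ^ d * (π ^ 2 / 4)) * (π / 2) ^ d * (cE * π ^ β) :=
            mul_le_mul (mul_le_mul hr (norm_uWeight_le hη hz) (norm_nonneg _) (by positivity)) hE0'
              (norm_nonneg _) (by positivity)
        _ = (π / 2) ^ d * ((π ^ 2 / 4) ^ d * (π ^ 2 / 4) * (cE * π ^ β)) := by ring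
    -- the other digits
    have hfar : ‖∑ w ∈ (digitBox d N).erase 0, fmodeTerm (DeltaEff a N m2 (sOf M q)) (N : ℝ)⁻¹ m2
        (aliasPt (sOf M q) w) ξ E‖ ≤ (π / 2) ^ d * (a * (π ^ 2 / 4) * cE * aliasConst d (β - 1)) := by
      refine (norm_sum_le _ _).trans ?_
      calc ∑ w ∈ (digitBox d N).erase 0, ‖fmodeTerm (DeltaEff a N m2 (sOf M q)) (N : ℝ)⁻¹ m2
              (aliasPt (sOf M q) w) ξ E‖
          ≤ ∑ w ∈ (digitBox d N).erase 0, a * (π ^ 2 / 4) * (π / 2) ^ d * cE * aliasTerm (β - 1) (sOf M q) w := by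
            refine Finset.sum_le_sum fun w hw => ?_
            have hw0 : w ≠ 0 := (Finset.mem_erase.mp hw).1
            have hwB : w ∈ digitBox d N := (Finset.mem_erase.mp hw).2
            have hq1 := one_le_norm_aliasPt hp hw0
            have hqpos : 0 < ‖aliasPt (sOf M q) w‖ := lt_of_lt_of_le one_pos hq1
            rw [norm_fmodeTerm hΔ0 hm.le]
            have h1 := modeAmp_alias_le hη hm.le hΔ0 hp hw0 (hzone w hwB)
            have h2 := hE q w
            have hW := aliasWeight_nonneg (sOf M q) w
            have hpow : ‖aliasPt (sOf M q) w‖ ^ (-2 : ℝ) * ‖aliasPt (sOf M q) w‖ ^ β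
                = ‖aliasPt (sOf M q) w‖ ^ (β - 1 - 1) := by
              rw [← Real.rpow_add hqpos]; congr 1; ring
            unfold aliasTerm
            calc modeAmp (DeltaEff a N m2 (sOf M q)) (N : ℝ)⁻¹ m2 (aliasPt (sOf M q) w) * ‖E (aliasPt (sOf M q) w)‖
                ≤ (DeltaEff a N m2 (sOf M q) * (π ^ 2 / 4 * ‖aliasPt (sOf M q) w‖ ^ (-2 : ℝ))
                    * ((π / 2) ^ d * aliasWeight (sOf M q) w)) * (cE * ‖aliasPt (sOf M q) w‖ ^ β) :=
                  mul_le_mul h1 h2 (norm_nonneg _) (by positivity)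
              _ ≤ (a * (π ^ 2 / 4 * ‖aliasPt (sOf M q) w‖ ^ (-2 : ℝ))
                    * ((π / 2) ^ d * aliasWeight (sOf M q) w)) * (cE * ‖aliasPt (sOf M q) w‖ ^ β) := by
                  gcongr
              _ = a * (π ^ 2 / 4) * (π / 2) ^ d * cE
                    * ((‖aliasPt (sOf M q) w‖ ^ (-2 : ℝ) * ‖aliasPt (sOf M q) w‖ ^ β) * aliasWeight (sOf M q) w) := by
                  ring
              _ = a * (π ^ 2 / 4) * (π / 2) ^ d * cE
                    * (‖aliasPt (sOf M q) w‖ ^ (β - 1 - 1) * aliasWeight (sOf M q) w) := by rw [hpow]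
        _ = a * (π ^ 2 / 4) * (π / 2) ^ d * cE * ∑ w ∈ (digitBox d N).erase 0, aliasTerm (β - 1) (sOf M q) w := by
            rw [Finset.mul_sum]
        _ ≤ a * (π ^ 2 / 4) * (π / 2) ^ d * cE * aliasConst d (β - 1) :=
            mul_le_mul_of_nonneg_left (alias_sum_le_of_subset hd (by linarith) hp (Finset.notMem_erase 0 _))
              (by positivity)
        _ = (π / 2) ^ d * (a * (π ^ 2 / 4) * cE * aliasConst d (β - 1)) := by ring
    rw [hBd]
    nlinarith [hcentral, hfar]
  -- average over the reduced momenta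
  have hnorm : ∀ r : ℝ, |r| = ‖((r : ℝ) : ℂ)‖ := fun r => by rw [Complex.norm_real, Real.norm_eq_abs]
  have hchi : ∀ q : Tor M, ‖conj (chi M q b)‖ = 1 := fun q => by
    rw [conj_chi]; unfold chi; rw [norm_prod]
    exact Finset.prod_eq_one fun μ _ => by rw [ZMod.stdAddChar_apply, Circle.norm_coe]
  rw [hnorm, hA, norm_mul, norm_inv, Complex.norm_natCast]
  have hsum : ‖∑ q : Tor M, conj (chi M q b)
      * ∑ w ∈ digitBox d N, fmodeTerm (DeltaEff a N m2 (sOf M q)) (N : ℝ)⁻¹ m2 (aliasPt (sOf M q) w) ξ E‖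
      ≤ ∑ _q : Tor M, Bd := by
    refine (norm_sum_le _ _).trans (Finset.sum_le_sum fun q _ => ?_)
    rw [norm_mul, hchi q, one_mul]
    exact hq q
  calc (Fintype.card (Tor M) : ℝ)⁻¹ * _ ≤ (Fintype.card (Tor M) : ℝ)⁻¹ * ∑ _q : Tor M, Bd :=
        mul_le_mul_of_nonneg_left hsum (by positivity)
    _ = Bd := by
        rw [Finset.sum_const, Finset.card_univ, nsmul_eq_mul, ← mul_assoc, inv_mul_cancel₀ hcard, one_mul]

/-! ## §2 The Lipschitz bound of the minimiser kernel in the fine point, uniformly in the spacing -/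

/-- **THE MINIMISER KERNEL IS LIPSCHITZ IN THE FINE POINT, UNIFORMLY IN `η`**: for odd `N`, `a > 0`, `m² > 0`, every unit
torus, all `x, y, b`: `||x − y|⁻¹(ℋ_k(x, b) − ℋ_k(y, b))| ≤ C_Lip := (π/2)^d·[(π²/4)^{d+1}·2dπ + a(π²/4)·2d·C(d, 0)]` — the
Hölder quotient (3.62) at exponent `1` of the ACTUAL kernel, through its digit sum (`holder_kernel_eq_digitSum`) and the
factor size `‖|x−y|⁻¹{1 − e^{iQ·(y−x)}}‖ ≤ 2d‖Q‖` (`norm_holderFac_le` at `α = 1`); the alias sum is (4.22) at exponent `0`.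
[cite: King1986, (3.62) p.663, (4.19)–(4.22) p.672] -/
theorem abs_holderOne_kernel_le_unif (hd : 0 < d) {N : ℕ} [NeZero N] (hN : Odd N) (hN1 : 1 ≤ N)
    (M : Fin d → ℕ) [hM : ∀ μ, NeZero (M μ)] {a m2 : ℝ} (ha : 0 < a) (hm : 0 < m2) (b : Tor M)
    (x y : Tor (fine N M)) :
    |(holdist N M x y) ^ (-(1 : ℝ)) * (minimiser N M a ((N : ℝ) ^ 2) m2 (Pi.single b 1) x
        - minimiser N M a ((N : ℝ) ^ 2) m2 (Pi.single b 1) y)|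
      ≤ (π / 2) ^ d * ((π ^ 2 / 4) ^ d * (π ^ 2 / 4) * (2 * (d : ℝ) * π)
          + a * (π ^ 2 / 4) * (2 * (d : ℝ)) * aliasConst d 0) := by
  have hA := holder_kernel_eq_digitSum N M hN hN1 ha hm 1 b x y
  have hE : ∀ (q : Tor M) (w : Fin d → ℤ),
      ‖holderFac 1 (holdist N M x y) (urep N M x y) (aliasPt (sOf M q) w)‖ ≤ 2 * (d : ℝ) * ‖aliasPt (sOf M q) w‖ ^ (1 : ℝ) := by
    intro q w
    have h := norm_holderFac_le (d := d) zero_le_one le_rfl (norm_urep_le N M x y) (aliasPt (sOf M q) w)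
    rwa [Real.rpow_one (d : ℝ)] at h
  have h := abs_le_of_factor_digitSum hd hN hN1 M ha hm b zero_le_one (by norm_num) (upos N M x)
    (holderFac 1 (holdist N M x y) (urep N M x y)) (by positivity) hE hA
  rw [Real.rpow_one, show ((1 : ℝ) - 1) = 0 by norm_num] at h
  exact h

/-! ## §3 Theorem 3.3 (3.8) ∕ Prop. 3.7 (3.65) for `ℋ_K`: the Hölder quotient decays, by interpolation -/

/-- Real interpolation: `0 ≤ A ≤ B`, `A ≤ C`, `0 ≤ s ≤ 1` ⟹ `A ≤ B^{s}C^{1−s}`. [folklore] -/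
private theorem le_rpow_interp' {A B C s : ℝ} (hA : 0 ≤ A) (hAB : A ≤ B) (hAC : A ≤ C) (hs0 : 0 ≤ s)
    (hs1 : s ≤ 1) : A ≤ B ^ s * C ^ (1 - s) := by
  have hB : 0 ≤ B := hA.trans hAB
  have hsplit : A = A ^ s * A ^ (1 - s) := by
    rw [← Real.rpow_add' hA (by ring_nf; norm_num), show s + (1 - s) = 1 by ring, Real.rpow_one]
  rw [hsplit]
  exact mul_le_mul (Real.rpow_le_rpow hA hAB hs0) (Real.rpow_le_rpow hA hAC (by linarith))
    (Real.rpow_nonneg hA _) (Real.rpow_nonneg hB _)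

/-- **THEOREM 3.3 (3.8) ∕ PROP. 3.7 (3.65) FOR KING'S MINIMISER KERNEL: THE HÖLDER QUOTIENT DECAYS.**  For `d ≥ 1`, odd
`L ≥ 2`, `a > 0`, `m² > 0`, `0 < α < 1` there are `δ, c > 0` (functions of `d, L, a, m², α` only; `δ = (1 − α)δ₀` with
`δ₀` the rate of `minimiser_kernel_decay_blocks`) such that for EVERY volume `(d, L, m, K)`, `K ≥ 1`, the unit torus
`M_μ = 2L^m`, every spelling `N = L^K`, all fine points `x, y` and unit sites `b`:
`||x − y|^{−α}(ℋ_K(x, b) − ℋ_K(y, b))| ≤ c·exp(−δ·min(tdistT M (B(x)) b, tdistT M (B(y)) b))` — King's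
`C exp[−δ₀dist({x, y}, z)]` for `∂_α(x, y)a_KG^η_KQ^*_K`, `|x − y|` the sup torus distance in unit coordinates.  Proof:
`A = |ℋ(x) − ℋ(y)| ≤ C_Lip·|x − y|` (§2) and `A ≤ 2ac₀e^{−δ₀min}` (the sup clause at both points); for `|x − y| ≤ 1`
interpolate with weights `α, 1 − α`, for `|x − y| > 1` use the second bound alone.
[cite: King1986, Theorem 3.3 (3.8) p.658, Prop. 3.7 (3.65) p.663; Balaban1983RegularityDecay, Theorem (1.10) p.573] -/
theorem holder_kernel_decay_blocks (dd L : ℕ) (hd : 1 ≤ dd) (hLodd : Odd L) (hL : 2 ≤ L) {a m2 : ℝ} (ha : 0 < a)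
    (hm : 0 < m2) {α : ℝ} (hα0 : 0 < α) (hα1 : α < 1) :
    ∃ δ c : ℝ, 0 < δ ∧ 0 < c ∧ ∀ (P : Params), P.d = dd → P.L = L → 1 ≤ P.K →
      ∀ (M : Fin P.d → ℕ) [∀ μ, NeZero (M μ)] (_hMK : ∀ μ, M μ = P.sitesPerDir P.K)
        (N : ℕ) [NeZero N] (_hN : N = P.L ^ P.K) (xt yt : Tor (fine N M)) (bt : Tor M),
        |(holdist N M xt yt) ^ (-α) * (minimiser N M (aK a P.L P.K) (((N : ℕ) : ℝ) ^ 2) m2 (Pi.single bt 1) xt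
            - minimiser N M (aK a P.L P.K) (((N : ℕ) : ℝ) ^ 2) m2 (Pi.single bt 1) yt)|
          ≤ c * Real.exp (-(δ * min (tdistT M (blockOf N M xt) bt) (tdistT M (blockOf N M yt) bt))) := by
  have hL1 : 1 < L := by omega
  obtain ⟨δ₀, c₀, hδ₀, hc₀, H⟩ := minimiser_kernel_decay_blocks dd L hd ⟨hLodd, hL1⟩ ha hm.le
  -- the Lipschitz constant (uniform in everything)
  set CL : ℝ := (π / 2) ^ dd * ((π ^ 2 / 4) ^ dd * (π ^ 2 / 4) * (2 * (dd : ℝ) * π)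
      + a * (π ^ 2 / 4) * (2 * (dd : ℝ)) * aliasConst dd 0) with hCL
  set c : ℝ := CL ^ α * (2 * (a * c₀)) ^ (1 - α) + 2 * (a * c₀) with hc
  have hd0 : 0 < dd := hd
  have hAC : 0 ≤ aliasConst dd 0 := by
    have h := alias_sum_le_of_subset (Λ := ∅) hd0 (show (0 : ℝ) < 1 by norm_num) (p := fun _ : Fin dd => (0 : ℝ))
      (fun μ => by rw [abs_zero]; exact Real.pi_pos.le) (Finset.notMem_empty 0)
    rwa [Finset.sum_empty] at h
  have hCL0 : 0 ≤ CL := by positivity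
  have hac : 0 < 2 * (a * c₀) := by positivity
  have hc1 : 0 ≤ CL ^ α * (2 * (a * c₀)) ^ (1 - α) := by positivity
  refine ⟨(1 - α) * δ₀, c, mul_pos (by linarith) hδ₀, by positivity, ?_⟩
  intro P hPd hPL hK M _ hMK N _ hN xt yt bt
  have hPd0 : 0 < P.d := by have := P.hd; omega
  have hLr : (1 : ℝ) < P.L := by exact_mod_cast P.hL.2
  have hPodd : Odd P.L := P.hL.1
  have hNodd : Odd N := by rw [hN]; exact hPodd.pow
  have hN1 : 1 ≤ N := by rw [hN]; exact Nat.one_le_pow _ _ (by have := P.hL.2; omega)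
  have haK : 0 < aK a P.L P.K := aK_pos ha hLr hK
  have haKa : aK a P.L P.K ≤ a := aK_le ha hLr hK
  set ρ := holdist N M xt yt with hρdef
  set m := min (tdistT M (blockOf N M xt) bt) (tdistT M (blockOf N M yt) bt) with hmdef
  have hρ0 : 0 ≤ ρ := holdist_nonneg N M xt yt
  have hm0 : 0 ≤ m := le_min (tdistT_nonneg M _ _) (tdistT_nonneg M _ _)
  rw [abs_mul, abs_of_nonneg (Real.rpow_nonneg hρ0 _)]
  set A := |minimiser N M (aK a P.L P.K) (((N : ℕ) : ℝ) ^ 2) m2 (Pi.single bt 1) xt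
      - minimiser N M (aK a P.L P.K) (((N : ℕ) : ℝ) ^ 2) m2 (Pi.single bt 1) yt| with hAdef
  -- the sup decay at both points
  have hx := H P hPd hPL hK M hMK N hN xt bt
  have hy := H P hPd hPL hK M hMK N hN yt bt
  have hDec : A ≤ 2 * (a * c₀) * Real.exp (-(δ₀ * m)) := by
    have ex : Real.exp (-(δ₀ * tdistT M (blockOf N M xt) bt)) ≤ Real.exp (-(δ₀ * m)) :=
      Real.exp_le_exp.mpr (neg_le_neg (mul_le_mul_of_nonneg_left (min_le_left _ _) hδ₀.le))
    have ey : Real.exp (-(δ₀ * tdistT M (blockOf N M yt) bt)) ≤ Real.exp (-(δ₀ * m)) :=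
      Real.exp_le_exp.mpr (neg_le_neg (mul_le_mul_of_nonneg_left (min_le_right _ _) hδ₀.le))
    have hx' : |minimiser N M (aK a P.L P.K) (((N : ℕ) : ℝ) ^ 2) m2 (Pi.single bt 1) xt|
        ≤ a * c₀ * Real.exp (-(δ₀ * m)) :=
      hx.trans (mul_le_mul (mul_le_mul_of_nonneg_right haKa hc₀.le) ex (Real.exp_pos _).le (by positivity))
    have hy' : |minimiser N M (aK a P.L P.K) (((N : ℕ) : ℝ) ^ 2) m2 (Pi.single bt 1) yt|
        ≤ a * c₀ * Real.exp (-(δ₀ * m)) :=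
      hy.trans (mul_le_mul (mul_le_mul_of_nonneg_right haKa hc₀.le) ey (Real.exp_pos _).le (by positivity))
    calc A ≤ |minimiser N M (aK a P.L P.K) (((N : ℕ) : ℝ) ^ 2) m2 (Pi.single bt 1) xt|
          + |minimiser N M (aK a P.L P.K) (((N : ℕ) : ℝ) ^ 2) m2 (Pi.single bt 1) yt| := abs_sub _ _
      _ ≤ a * c₀ * Real.exp (-(δ₀ * m)) + a * c₀ * Real.exp (-(δ₀ * m)) := add_le_add hx' hy'
      _ = 2 * (a * c₀) * Real.exp (-(δ₀ * m)) := by ring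
  have hexpδ : Real.exp (-(δ₀ * m)) ≤ Real.exp (-((1 - α) * δ₀ * m)) :=
    Real.exp_le_exp.mpr (by nlinarith [mul_nonneg (mul_nonneg hα0.le hδ₀.le) hm0])
  rcases hρ0.eq_or_lt with h0 | hρpos
  · -- |x − y| = 0: the prefactor vanishes (`α > 0`)
    rw [← h0, Real.zero_rpow (by linarith), zero_mul]
    positivity
  rcases le_or_gt ρ 1 with hρ1 | hρ1
  · -- |x − y| ≤ 1: interpolate between the Lipschitz bound and the sup decay
    have hLip0 := abs_holderOne_kernel_le_unif hPd0 hNodd hN1 M haK hm bt xt yt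
    have hLip : A ≤ CL * ρ := by
      have h1 : A = ρ * |ρ ^ (-(1 : ℝ)) * (minimiser N M (aK a P.L P.K) (((N : ℕ) : ℝ) ^ 2) m2 (Pi.single bt 1) xt
          - minimiser N M (aK a P.L P.K) (((N : ℕ) : ℝ) ^ 2) m2 (Pi.single bt 1) yt)| := by
        rw [abs_mul, abs_of_nonneg (Real.rpow_nonneg hρ0 _), Real.rpow_neg hρ0, Real.rpow_one, ← mul_assoc,
          mul_inv_cancel₀ hρpos.ne', one_mul]
      have hCL' : |ρ ^ (-(1 : ℝ)) * (minimiser N M (aK a P.L P.K) (((N : ℕ) : ℝ) ^ 2) m2 (Pi.single bt 1) xt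
          - minimiser N M (aK a P.L P.K) (((N : ℕ) : ℝ) ^ 2) m2 (Pi.single bt 1) yt)| ≤ CL := by
        refine hLip0.trans ?_
        rw [hCL, ← hPd]
        have hAC' : 0 ≤ aliasConst P.d 0 := by rw [hPd]; exact hAC
        have h3 : aK a P.L P.K * (π ^ 2 / 4) * (2 * (P.d : ℝ)) * aliasConst P.d 0
            ≤ a * (π ^ 2 / 4) * (2 * (P.d : ℝ)) * aliasConst P.d 0 :=
          mul_le_mul_of_nonneg_right (mul_le_mul_of_nonneg_right
            (mul_le_mul_of_nonneg_right haKa (by positivity)) (by positivity)) hAC'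
        have h4 : (0 : ℝ) ≤ (π / 2) ^ P.d := by positivity
        exact mul_le_mul_of_nonneg_left (add_le_add le_rfl h3) h4
      rw [h1, mul_comm]
      exact mul_le_mul_of_nonneg_right hCL' hρ0
    have hint := le_rpow_interp' (abs_nonneg _) hLip hDec hα0.le hα1.le
    rw [← hAdef] at hint
    have e1 : (CL * ρ) ^ α * (2 * (a * c₀) * Real.exp (-(δ₀ * m))) ^ (1 - α)
        = CL ^ α * (2 * (a * c₀)) ^ (1 - α) * ρ ^ α * Real.exp (-((1 - α) * δ₀ * m)) := by
      rw [Real.mul_rpow hCL0 hρ0, Real.mul_rpow hac.le (Real.exp_pos _).le, ← Real.exp_mul,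
        show -(δ₀ * m) * (1 - α) = -((1 - α) * δ₀ * m) by ring]
      ring
    rw [e1] at hint
    calc ρ ^ (-α) * A ≤ ρ ^ (-α) * (CL ^ α * (2 * (a * c₀)) ^ (1 - α) * ρ ^ α * Real.exp (-((1 - α) * δ₀ * m))) :=
          mul_le_mul_of_nonneg_left hint (Real.rpow_nonneg hρ0 _)
      _ = CL ^ α * (2 * (a * c₀)) ^ (1 - α) * (ρ ^ (-α) * ρ ^ α) * Real.exp (-((1 - α) * δ₀ * m)) := by ring
      _ = CL ^ α * (2 * (a * c₀)) ^ (1 - α) * Real.exp (-((1 - α) * δ₀ * m)) := by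
          rw [← Real.rpow_add hρpos, neg_add_cancel, Real.rpow_zero, mul_one]
      _ ≤ c * Real.exp (-((1 - α) * δ₀ * m)) := by
          refine mul_le_mul_of_nonneg_right ?_ (Real.exp_pos _).le
          rw [hc]; linarith [hac.le]
  · -- |x − y| > 1: the prefactor is ≤ 1 and the sup decay suffices
    have hpre : ρ ^ (-α) ≤ 1 := by
      rw [Real.rpow_neg hρ0]
      exact inv_le_one_of_one_le₀ (Real.one_le_rpow hρ1.le hα0.le)
    calc ρ ^ (-α) * A ≤ 1 * (2 * (a * c₀) * Real.exp (-(δ₀ * m))) :=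
          mul_le_mul hpre hDec (abs_nonneg _) zero_le_one
      _ ≤ 2 * (a * c₀) * Real.exp (-((1 - α) * δ₀ * m)) := by
          rw [one_mul]; exact mul_le_mul_of_nonneg_left hexpδ hac.le
      _ ≤ c * Real.exp (-((1 - α) * δ₀ * m)) := by
          refine mul_le_mul_of_nonneg_right ?_ (Real.exp_pos _).le
          rw [hc]; linarith [hc1]

/-! ## §4 (3.71), third line, in its printed shape — unconditional on Bałaban's volumes -/

/-- **KING'S (3.71), THIRD LINE, IN ITS PRINTED SHAPE `≦ CL^{−γk}exp[−δ₀dist({x, y}, z)]`, FOR THE ACTUAL OPERATORS ON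
BAŁABAN'S VOLUMES — UNCONDITIONAL.**  For `d ≥ 1`, odd `L ≥ 2`, `a > 0`, `m² > 0`, `0 < α`, `0 < γ`, `α + γ ≤ 1` there are
`δ, c > 0` (functions of `d, L, a, m², α`) such that for every volume `P = (d, L, m, K)` (`K ≥ 1`), every `n ≥ 1`, the unit
torus `M_μ = 2L^m`, fine points `x′, y′` over `x, y` and every unit site `b`:
`||x′ − y′|^{−α}(ℋ_{K+n}(x′,b) − ℋ_{K+n}(y′,b)) − |x − y|^{−α}(ℋ_K(x,b) − ℋ_K(y,b))| ≤ √(2c(C₁ + C₂)·L^{−γK})·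
exp(−(δ∕2)·min(|B(x) − b|, |B(y) − b|))` — `C₁, C₂` the constants of `king_prop38_holder_torus` (`θ = lemma43Const a L K n`),
`γ′ = γ∕2`, `δ₀′ = δ∕2 = (1 − α)δ₀∕2`; inputs: the sup rate (file 12), the Hölder decay §3 for both runs (their blocks
agree, `blockOf_over`), the interpolation `abs_le_sqrt_mul_exp_half` («combining our bounds with Theorem 3.3», p. 674).
[cite: King1986, Prop. 3.8 (3.71) p.664, p.674] -/
theorem king_prop38_holder_torus_blocks (dd L : ℕ) (hd : 1 ≤ dd) (hLodd : Odd L) (hL : 2 ≤ L) {a m2 : ℝ}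
    (ha : 0 < a) (hm : 0 < m2) {α γ : ℝ} (hα : 0 < α) (hγ : 0 < γ) (hαγ : α + γ ≤ 1) :
    ∃ δ c : ℝ, 0 < δ ∧ 0 < c ∧ ∀ (P : Params) (_hPd : P.d = dd) (_hPL : P.L = L) (_hK : 1 ≤ P.K) [NeZero P.L]
      (n : ℕ) (_hn : 1 ≤ n) (M : Fin P.d → ℕ) [∀ μ, NeZero (M μ)] (_hMK : ∀ μ, M μ = P.sitesPerDir P.K)
      (xt yt : Tor (fine (P.L ^ P.K) M)) (xt' yt' : Tor (fine (P.L ^ n * P.L ^ P.K) M)) (bt : Tor M)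
      (_hxx : ∀ μ, (xt μ).val = (xt' μ).val / P.L ^ n) (_hyy : ∀ μ, (yt μ).val = (yt' μ).val / P.L ^ n),
      |(holdist (P.L ^ n * P.L ^ P.K) M xt' yt') ^ (-α)
          * (minimiser (P.L ^ n * P.L ^ P.K) M (aK a P.L (P.K + n)) (((P.L ^ n * P.L ^ P.K : ℕ) : ℝ) ^ 2) m2
              (Pi.single bt 1) xt'
            - minimiser (P.L ^ n * P.L ^ P.K) M (aK a P.L (P.K + n)) (((P.L ^ n * P.L ^ P.K : ℕ) : ℝ) ^ 2) m2
              (Pi.single bt 1) yt')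
        - (holdist (P.L ^ P.K) M xt yt) ^ (-α)
          * (minimiser (P.L ^ P.K) M (aK a P.L P.K) (((P.L ^ P.K : ℕ) : ℝ) ^ 2) m2 (Pi.single bt 1) xt
            - minimiser (P.L ^ P.K) M (aK a P.L P.K) (((P.L ^ P.K : ℕ) : ℝ) ^ 2) m2 (Pi.single bt 1) yt)|
        ≤ Real.sqrt (((fprop38RateConst a a (lemma43Const a P.L P.K n) ((π ^ 2 / 4) ^ P.d) P.d γ α
                  (2 * (P.d : ℝ) ^ α) 0
                + fprop38PosConst a ((π ^ 2 / 4) ^ P.d) P.d γ α (2 * (P.d : ℝ) ^ α) (6 * (P.d : ℝ) ^ (α + γ)))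
              * ((P.L ^ P.K : ℕ) : ℝ) ^ (-γ)) * (2 * c))
          * Real.exp (-(δ / 2 * min (tdistT M (blockOf (P.L ^ P.K) M xt) bt) (tdistT M (blockOf (P.L ^ P.K) M yt) bt))) := by
  have hα1 : α < 1 := by linarith
  obtain ⟨δ, c, hδ, hc, H⟩ := holder_kernel_decay_blocks dd L hd hLodd hL ha hm hα hα1
  refine ⟨δ, c, hδ, hc, ?_⟩
  intro P hPd hPL hK _ n hn M _ hMK xt yt xt' yt' bt hxx hyy
  have hPd0 : 0 < P.d := by have := P.hd; omega
  have hPodd : Odd P.L := P.hL.1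
  have hPL2 : 2 ≤ P.L := by have := P.hL.2; omega
  set m := min (tdistT M (blockOf (P.L ^ P.K) M xt) bt) (tdistT M (blockOf (P.L ^ P.K) M yt) bt) with hmdef
  -- run A
  have hA := H P hPd hPL hK M hMK (P.L ^ P.K) rfl xt yt bt
  -- run B on the volume `(d, L, m, K + n)`: same blocks
  have hMK' : ∀ ν, M ν = (⟨P.d, P.L, P.m, P.K + n, P.hd, P.hL⟩ : Params).sitesPerDir (P.K + n) := fun ν => by
    rw [hMK ν]; exact (sitesPerDir_finerVolume P n).symm
  have hN : P.L ^ n * P.L ^ P.K = P.L ^ (P.K + n) := by rw [pow_add, mul_comm]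
  have hB := H (⟨P.d, P.L, P.m, P.K + n, P.hd, P.hL⟩ : Params) hPd hPL (show 1 ≤ P.K + n by omega) M hMK'
    (P.L ^ n * P.L ^ P.K) hN xt' yt' bt
  rw [blockOf_over M xt xt' hxx, blockOf_over M yt yt' hyy] at hB
  -- the sup rate
  have hrate := king_prop38_holder_torus hPd0 hPodd hPL2 hK hn M ha hm hα.le hγ hαγ bt xt yt xt' yt' hxx hyy
  have hε : 0 ≤ (fprop38RateConst a a (lemma43Const a P.L P.K n) ((π ^ 2 / 4) ^ P.d) P.d γ α (2 * (P.d : ℝ) ^ α) 0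
      + fprop38PosConst a ((π ^ 2 / 4) ^ P.d) P.d γ α (2 * (P.d : ℝ) ^ α) (6 * (P.d : ℝ) ^ (α + γ)))
      * ((P.L ^ P.K : ℕ) : ℝ) ^ (-γ) := (abs_nonneg _).trans hrate
  refine abs_le_sqrt_mul_exp_half hε hrate ?_
  calc _ ≤ |(holdist (P.L ^ n * P.L ^ P.K) M xt' yt') ^ (-α)
            * (minimiser (P.L ^ n * P.L ^ P.K) M (aK a P.L (P.K + n)) (((P.L ^ n * P.L ^ P.K : ℕ) : ℝ) ^ 2) m2
                (Pi.single bt 1) xt'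
              - minimiser (P.L ^ n * P.L ^ P.K) M (aK a P.L (P.K + n)) (((P.L ^ n * P.L ^ P.K : ℕ) : ℝ) ^ 2) m2
                (Pi.single bt 1) yt')|
        + |(holdist (P.L ^ P.K) M xt yt) ^ (-α)
            * (minimiser (P.L ^ P.K) M (aK a P.L P.K) (((P.L ^ P.K : ℕ) : ℝ) ^ 2) m2 (Pi.single bt 1) xt
              - minimiser (P.L ^ P.K) M (aK a P.L P.K) (((P.L ^ P.K : ℕ) : ℝ) ^ 2) m2 (Pi.single bt 1) yt)| :=
        abs_sub _ _
    _ ≤ c * Real.exp (-(δ * m)) + c * Real.exp (-(δ * m)) := add_le_add hB hA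
    _ = 2 * c * Real.exp (-(δ * m)) := by ring

/-! ## §5 The fourth line: the Hölder-`s` bound of the lattice DERIVATIVE (any `s < 1`) and its Hölder-quotient decay -/

/-- **THE LATTICE DERIVATIVE OF THE MINIMISER KERNEL IS HÖLDER-`s` IN THE FINE POINT FOR EVERY `s < 1`, UNIFORMLY IN `η`**:
for odd `N`, `a > 0`, `m² > 0`, `0 ≤ s < 1`, every unit torus, all `x, y, b`, `μ`:
`||x − y|^{−s}(∂^η_μℋ_k(x, b) − ∂^η_μℋ_k(y, b))| ≤ (π/2)^d·[(π²/4)^{d+1}·2d^sπ^{1+s} + a(π²/4)·2d^s·C(d, s)]` — the digit sum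
`holder_dkernel_eq_digitSum` with the factor size `2d^s‖Q‖^{s+1}` (`norm_fdq_mul_holderFac_le`); the alias sum is (4.22)
at exponent `s`, which is why `s = 1` is excluded (King's «α + γ < 1» for the fourth line).
[cite: King1986, (3.62) p.663, (4.19)–(4.22) p.672] -/
theorem abs_holderS_dkernel_le_unif (hd : 0 < d) {N : ℕ} [NeZero N] (hN : Odd N) (hN1 : 1 ≤ N)
    (M : Fin d → ℕ) [hM : ∀ μ, NeZero (M μ)] {a m2 : ℝ} (ha : 0 < a) (hm : 0 < m2) {s : ℝ} (hs0 : 0 ≤ s)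
    (hs1 : s < 1) (b : Tor M) (x y : Tor (fine N M)) (μ : Fin d) :
    |(holdist N M x y) ^ (-s)
        * ((N : ℝ) * (minimiser N M a ((N : ℝ) ^ 2) m2 (Pi.single b 1) (x + unitVec (fine N M) μ)
            - minimiser N M a ((N : ℝ) ^ 2) m2 (Pi.single b 1) x)
          - (N : ℝ) * (minimiser N M a ((N : ℝ) ^ 2) m2 (Pi.single b 1) (y + unitVec (fine N M) μ)
            - minimiser N M a ((N : ℝ) ^ 2) m2 (Pi.single b 1) y))|
      ≤ (π / 2) ^ d * ((π ^ 2 / 4) ^ d * (π ^ 2 / 4) * (2 * (d : ℝ) ^ s * π ^ (s + 1))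
          + a * (π ^ 2 / 4) * (2 * (d : ℝ) ^ s) * aliasConst d s) := by
  have hNr : (0 : ℝ) < N := by exact_mod_cast (show 0 < N by omega)
  have hA := holder_dkernel_eq_digitSum N M hN hN1 ha hm s b x y μ
  have hE : ∀ (q : Tor M) (w : Fin d → ℤ),
      ‖fdq (N : ℝ)⁻¹ (-(aliasPt (sOf M q) w μ)) * holderFac s (holdist N M x y) (urep N M x y) (aliasPt (sOf M q) w)‖
        ≤ 2 * (d : ℝ) ^ s * ‖aliasPt (sOf M q) w‖ ^ (s + 1) :=
    fun q w => norm_fdq_mul_holderFac_le (inv_pos.mpr hNr) hs0 hs1.le (norm_urep_le N M x y) _ μ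
  have h := abs_le_of_factor_digitSum hd hN hN1 M ha hm b (by linarith : 0 ≤ s + 1) (by linarith : s + 1 < 2)
    (upos N M x) (fun Q => fdq (N : ℝ)⁻¹ (-(Q μ)) * holderFac s (holdist N M x y) (urep N M x y) Q)
    (by positivity) hE hA
  rw [show s + 1 - 1 = s by ring] at h
  exact h

/-- **THEOREM 3.3 (3.8) ∕ PROP. 3.7 (3.65) FOR THE LATTICE DERIVATIVE OF KING'S MINIMISER KERNEL: THE HÖLDER QUOTIENT OF
`∂^η_μℋ_K` DECAYS.**  For `d ≥ 1`, odd `L ≥ 2`, `a > 0`, `m² > 0`, `0 < α < 1` there are `δ, c > 0` (functions of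
`d, L, a, m², α`; `δ = (1 − α)∕(1 + α)·δ₀`) such that for every volume, `N = L^K`, all `x, y, b, μ`:
`||x − y|^{−α}(∂^η_μℋ_K(x, b) − ∂^η_μℋ_K(y, b))| ≤ c·exp(−δ·min(|B(x) − b|, |B(y) − b|))` — interpolation between the
Hölder-`s` bound of §5 at `s = (1 + α)∕2` (weight `t = α∕s`) and the derivative sup clause
`dminimiser_kernel_decay_blocks` at both points (weight `1 − t`). [cite: King1986, Theorem 3.3 (3.8) p.658, Prop. 3.7 (3.65) p.663] -/
theorem holder_dkernel_decay_blocks (dd L : ℕ) (hd : 1 ≤ dd) (hLodd : Odd L) (hL : 2 ≤ L) {a m2 : ℝ} (ha : 0 < a)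
    (hm : 0 < m2) {α : ℝ} (hα0 : 0 < α) (hα1 : α < 1) :
    ∃ δ c : ℝ, 0 < δ ∧ 0 < c ∧ ∀ (P : Params), P.d = dd → P.L = L → 1 ≤ P.K →
      ∀ (M : Fin P.d → ℕ) [∀ μ, NeZero (M μ)] (_hMK : ∀ μ, M μ = P.sitesPerDir P.K)
        (N : ℕ) [NeZero N] (_hN : N = P.L ^ P.K) (xt yt : Tor (fine N M)) (bt : Tor M) (μ : Fin P.d),
        |(holdist N M xt yt) ^ (-α)
            * ((N : ℝ) * (minimiser N M (aK a P.L P.K) (((N : ℕ) : ℝ) ^ 2) m2 (Pi.single bt 1) (xt + unitVec (fine N M) μ)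
                - minimiser N M (aK a P.L P.K) (((N : ℕ) : ℝ) ^ 2) m2 (Pi.single bt 1) xt)
              - (N : ℝ) * (minimiser N M (aK a P.L P.K) (((N : ℕ) : ℝ) ^ 2) m2 (Pi.single bt 1) (yt + unitVec (fine N M) μ)
                - minimiser N M (aK a P.L P.K) (((N : ℕ) : ℝ) ^ 2) m2 (Pi.single bt 1) yt))|
          ≤ c * Real.exp (-(δ * min (tdistT M (blockOf N M xt) bt) (tdistT M (blockOf N M yt) bt))) := by
  have hL1 : 1 < L := by omega
  obtain ⟨δ₀, c₀, hδ₀, hc₀, H⟩ := dminimiser_kernel_decay_blocks dd L hd ⟨hLodd, hL1⟩ ha hm.le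
  -- exponents
  set s : ℝ := (1 + α) / 2 with hs
  set t : ℝ := α / s with ht
  have hs0 : 0 < s := by rw [hs]; linarith
  have hs1 : s < 1 := by rw [hs]; linarith
  have hαs : α < s := by rw [hs]; linarith
  have ht0 : 0 < t := div_pos hα0 hs0
  have ht1 : t < 1 := (div_lt_one hs0).mpr hαs
  have hst : s * t = α := by rw [ht]; field_simp
  -- the Hölder-s constant
  set CS : ℝ := (π / 2) ^ dd * ((π ^ 2 / 4) ^ dd * (π ^ 2 / 4) * (2 * (dd : ℝ) ^ s * π ^ (s + 1))
      + a * (π ^ 2 / 4) * (2 * (dd : ℝ) ^ s) * aliasConst dd s) with hCS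
  set c : ℝ := CS ^ t * (2 * (a * c₀)) ^ (1 - t) + 2 * (a * c₀) with hc
  have hd0 : 0 < dd := hd
  have hAC : 0 ≤ aliasConst dd s := by
    have h := alias_sum_le_of_subset (Λ := ∅) hd0 hs1 (p := fun _ : Fin dd => (0 : ℝ))
      (fun μ => by rw [abs_zero]; exact Real.pi_pos.le) (Finset.notMem_empty 0)
    rwa [Finset.sum_empty] at h
  have hCS0 : 0 ≤ CS := by positivity
  have hac : 0 < 2 * (a * c₀) := by positivity
  have hc1 : 0 ≤ CS ^ t * (2 * (a * c₀)) ^ (1 - t) := by positivity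
  refine ⟨(1 - t) * δ₀, c, mul_pos (by linarith) hδ₀, by positivity, ?_⟩
  intro P hPd hPL hK M _ hMK N _ hN xt yt bt μ
  have hPd0 : 0 < P.d := by have := P.hd; omega
  have hLr : (1 : ℝ) < P.L := by exact_mod_cast P.hL.2
  have hPodd : Odd P.L := P.hL.1
  have hNodd : Odd N := by rw [hN]; exact hPodd.pow
  have hN1 : 1 ≤ N := by rw [hN]; exact Nat.one_le_pow _ _ (by have := P.hL.2; omega)
  have haK : 0 < aK a P.L P.K := aK_pos ha hLr hK
  have haKa : aK a P.L P.K ≤ a := aK_le ha hLr hK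
  set ρ := holdist N M xt yt with hρdef
  set m := min (tdistT M (blockOf N M xt) bt) (tdistT M (blockOf N M yt) bt) with hmdef
  have hρ0 : 0 ≤ ρ := holdist_nonneg N M xt yt
  have hm0 : 0 ≤ m := le_min (tdistT_nonneg M _ _) (tdistT_nonneg M _ _)
  rw [abs_mul, abs_of_nonneg (Real.rpow_nonneg hρ0 _)]
  set DX := (N : ℝ) * (minimiser N M (aK a P.L P.K) (((N : ℕ) : ℝ) ^ 2) m2 (Pi.single bt 1) (xt + unitVec (fine N M) μ)
      - minimiser N M (aK a P.L P.K) (((N : ℕ) : ℝ) ^ 2) m2 (Pi.single bt 1) xt) with hDX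
  set DY := (N : ℝ) * (minimiser N M (aK a P.L P.K) (((N : ℕ) : ℝ) ^ 2) m2 (Pi.single bt 1) (yt + unitVec (fine N M) μ)
      - minimiser N M (aK a P.L P.K) (((N : ℕ) : ℝ) ^ 2) m2 (Pi.single bt 1) yt) with hDY
  set A := |DX - DY| with hAdef
  -- the sup decay of the derivative at both points
  have hx := H P hPd hPL hK M hMK N hN xt bt μ
  have hy := H P hPd hPL hK M hMK N hN yt bt μ
  have hDec : A ≤ 2 * (a * c₀) * Real.exp (-(δ₀ * m)) := by
    have ex : Real.exp (-(δ₀ * tdistT M (blockOf N M xt) bt)) ≤ Real.exp (-(δ₀ * m)) :=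
      Real.exp_le_exp.mpr (neg_le_neg (mul_le_mul_of_nonneg_left (min_le_left _ _) hδ₀.le))
    have ey : Real.exp (-(δ₀ * tdistT M (blockOf N M yt) bt)) ≤ Real.exp (-(δ₀ * m)) :=
      Real.exp_le_exp.mpr (neg_le_neg (mul_le_mul_of_nonneg_left (min_le_right _ _) hδ₀.le))
    have hx' : |DX| ≤ a * c₀ * Real.exp (-(δ₀ * m)) :=
      hx.trans (mul_le_mul (mul_le_mul_of_nonneg_right haKa hc₀.le) ex (Real.exp_pos _).le (by positivity))
    have hy' : |DY| ≤ a * c₀ * Real.exp (-(δ₀ * m)) :=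
      hy.trans (mul_le_mul (mul_le_mul_of_nonneg_right haKa hc₀.le) ey (Real.exp_pos _).le (by positivity))
    calc A ≤ |DX| + |DY| := abs_sub _ _
      _ ≤ a * c₀ * Real.exp (-(δ₀ * m)) + a * c₀ * Real.exp (-(δ₀ * m)) := add_le_add hx' hy'
      _ = 2 * (a * c₀) * Real.exp (-(δ₀ * m)) := by ring
  have hexpδ : Real.exp (-(δ₀ * m)) ≤ Real.exp (-((1 - t) * δ₀ * m)) :=
    Real.exp_le_exp.mpr (by nlinarith [mul_nonneg (mul_nonneg ht0.le hδ₀.le) hm0])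
  rcases hρ0.eq_or_lt with h0 | hρpos
  · rw [← h0, Real.zero_rpow (by linarith), zero_mul]
    positivity
  rcases le_or_gt ρ 1 with hρ1 | hρ1
  · -- |x − y| ≤ 1: interpolate between the Hölder-s bound and the sup decay
    have hS0 := abs_holderS_dkernel_le_unif hPd0 hNodd hN1 M haK hm hs0.le hs1 bt xt yt μ
    have hS : A ≤ CS * ρ ^ s := by
      have h1 : A = ρ ^ s * |ρ ^ (-s) * (DX - DY)| := by
        rw [abs_mul, abs_of_nonneg (Real.rpow_nonneg hρ0 _), ← mul_assoc, ← Real.rpow_add hρpos, add_neg_cancel,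
          Real.rpow_zero, one_mul]
      have hCS' : |ρ ^ (-s) * (DX - DY)| ≤ CS := by
        refine hS0.trans ?_
        rw [hCS, ← hPd]
        have hAC' : 0 ≤ aliasConst P.d s := by rw [hPd]; exact hAC
        have h3 : aK a P.L P.K * (π ^ 2 / 4) * (2 * (P.d : ℝ) ^ s) * aliasConst P.d s
            ≤ a * (π ^ 2 / 4) * (2 * (P.d : ℝ) ^ s) * aliasConst P.d s :=
          mul_le_mul_of_nonneg_right (mul_le_mul_of_nonneg_right
            (mul_le_mul_of_nonneg_right haKa (by positivity)) (by positivity)) hAC'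
        have h4 : (0 : ℝ) ≤ (π / 2) ^ P.d := by positivity
        exact mul_le_mul_of_nonneg_left (add_le_add le_rfl h3) h4
      rw [h1, mul_comm]
      exact mul_le_mul_of_nonneg_right hCS' (Real.rpow_nonneg hρ0 _)
    have hint := le_rpow_interp' (abs_nonneg _) hS hDec ht0.le ht1.le
    rw [← hAdef] at hint
    have e1 : (CS * ρ ^ s) ^ t * (2 * (a * c₀) * Real.exp (-(δ₀ * m))) ^ (1 - t)
        = CS ^ t * (2 * (a * c₀)) ^ (1 - t) * ρ ^ α * Real.exp (-((1 - t) * δ₀ * m)) := by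
      rw [Real.mul_rpow hCS0 (Real.rpow_nonneg hρ0 _), Real.mul_rpow hac.le (Real.exp_pos _).le, ← Real.exp_mul,
        ← Real.rpow_mul hρ0, hst, show -(δ₀ * m) * (1 - t) = -((1 - t) * δ₀ * m) by ring]
      ring
    rw [e1] at hint
    calc ρ ^ (-α) * A ≤ ρ ^ (-α) * (CS ^ t * (2 * (a * c₀)) ^ (1 - t) * ρ ^ α * Real.exp (-((1 - t) * δ₀ * m))) :=
          mul_le_mul_of_nonneg_left hint (Real.rpow_nonneg hρ0 _)
      _ = CS ^ t * (2 * (a * c₀)) ^ (1 - t) * (ρ ^ (-α) * ρ ^ α) * Real.exp (-((1 - t) * δ₀ * m)) := by ring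
      _ = CS ^ t * (2 * (a * c₀)) ^ (1 - t) * Real.exp (-((1 - t) * δ₀ * m)) := by
          rw [← Real.rpow_add hρpos, neg_add_cancel, Real.rpow_zero, mul_one]
      _ ≤ c * Real.exp (-((1 - t) * δ₀ * m)) := by
          refine mul_le_mul_of_nonneg_right ?_ (Real.exp_pos _).le
          rw [hc]; linarith [hac.le]
  · -- |x − y| > 1
    have hpre : ρ ^ (-α) ≤ 1 := by
      rw [Real.rpow_neg hρ0]
      exact inv_le_one_of_one_le₀ (Real.one_le_rpow hρ1.le hα0.le)
    calc ρ ^ (-α) * A ≤ 1 * (2 * (a * c₀) * Real.exp (-(δ₀ * m))) :=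
          mul_le_mul hpre hDec (abs_nonneg _) zero_le_one
      _ ≤ 2 * (a * c₀) * Real.exp (-((1 - t) * δ₀ * m)) := by
          rw [one_mul]; exact mul_le_mul_of_nonneg_left hexpδ hac.le
      _ ≤ c * Real.exp (-((1 - t) * δ₀ * m)) := by
          refine mul_le_mul_of_nonneg_right ?_ (Real.exp_pos _).le
          rw [hc]; linarith [hc1]

/-! ## §6 (3.71), fourth line, in its printed shape — unconditional on Bałaban's volumes -/

/-- **KING'S (3.71), FOURTH LINE, IN ITS PRINTED SHAPE, FOR THE ACTUAL OPERATORS ON BAŁABAN'S VOLUMES — UNCONDITIONAL.**  For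
`d ≥ 1`, odd `L ≥ 2`, `a > 0`, `m² > 0`, `0 < α`, `0 < γ`, `α + γ < 1` there are `δ, c > 0` (functions of `d, L, a, m², α`)
such that for every volume (`K ≥ 1`), `n ≥ 1`, the unit torus `2L^m`, fine points `x′, y′` over `x, y`, every `b`, `μ`:
`||x′ − y′|^{−α}(∂^{η′}_μℋ_{K+n}(x′,b) − ∂^{η′}_μℋ_{K+n}(y′,b)) − |x − y|^{−α}(∂^η_μℋ_K(x,b) − ∂^η_μℋ_K(y,b))| ≤
√(2c(C₁ + C₂)L^{−γK})·exp(−(δ∕2)·min(|B(x) − b|, |B(y) − b|))` with `C₁, C₂` the constants of `king_prop38_holder_deriv_torus`.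
[cite: King1986, Prop. 3.8 (3.71) p.664, p.674] -/
theorem king_prop38_holder_deriv_torus_blocks (dd L : ℕ) (hd : 1 ≤ dd) (hLodd : Odd L) (hL : 2 ≤ L) {a m2 : ℝ}
    (ha : 0 < a) (hm : 0 < m2) {α γ : ℝ} (hα : 0 < α) (hγ : 0 < γ) (hαγ : α + γ < 1) :
    ∃ δ c : ℝ, 0 < δ ∧ 0 < c ∧ ∀ (P : Params) (_hPd : P.d = dd) (_hPL : P.L = L) (_hK : 1 ≤ P.K) [NeZero P.L]
      (n : ℕ) (_hn : 1 ≤ n) (M : Fin P.d → ℕ) [∀ μ, NeZero (M μ)] (_hMK : ∀ μ, M μ = P.sitesPerDir P.K)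
      (xt yt : Tor (fine (P.L ^ P.K) M)) (xt' yt' : Tor (fine (P.L ^ n * P.L ^ P.K) M)) (bt : Tor M)
      (_hxx : ∀ μ, (xt μ).val = (xt' μ).val / P.L ^ n) (_hyy : ∀ μ, (yt μ).val = (yt' μ).val / P.L ^ n) (μ : Fin P.d),
      |(holdist (P.L ^ n * P.L ^ P.K) M xt' yt') ^ (-α)
          * (((P.L ^ n * P.L ^ P.K : ℕ) : ℝ)
              * (minimiser (P.L ^ n * P.L ^ P.K) M (aK a P.L (P.K + n)) (((P.L ^ n * P.L ^ P.K : ℕ) : ℝ) ^ 2) m2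
                  (Pi.single bt 1) (xt' + unitVec (fine (P.L ^ n * P.L ^ P.K) M) μ)
                - minimiser (P.L ^ n * P.L ^ P.K) M (aK a P.L (P.K + n)) (((P.L ^ n * P.L ^ P.K : ℕ) : ℝ) ^ 2) m2
                  (Pi.single bt 1) xt')
            - ((P.L ^ n * P.L ^ P.K : ℕ) : ℝ)
              * (minimiser (P.L ^ n * P.L ^ P.K) M (aK a P.L (P.K + n)) (((P.L ^ n * P.L ^ P.K : ℕ) : ℝ) ^ 2) m2
                  (Pi.single bt 1) (yt' + unitVec (fine (P.L ^ n * P.L ^ P.K) M) μ)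
                - minimiser (P.L ^ n * P.L ^ P.K) M (aK a P.L (P.K + n)) (((P.L ^ n * P.L ^ P.K : ℕ) : ℝ) ^ 2) m2
                  (Pi.single bt 1) yt'))
        - (holdist (P.L ^ P.K) M xt yt) ^ (-α)
          * (((P.L ^ P.K : ℕ) : ℝ)
              * (minimiser (P.L ^ P.K) M (aK a P.L P.K) (((P.L ^ P.K : ℕ) : ℝ) ^ 2) m2 (Pi.single bt 1)
                  (xt + unitVec (fine (P.L ^ P.K) M) μ)
                - minimiser (P.L ^ P.K) M (aK a P.L P.K) (((P.L ^ P.K : ℕ) : ℝ) ^ 2) m2 (Pi.single bt 1) xt)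
            - ((P.L ^ P.K : ℕ) : ℝ)
              * (minimiser (P.L ^ P.K) M (aK a P.L P.K) (((P.L ^ P.K : ℕ) : ℝ) ^ 2) m2 (Pi.single bt 1)
                  (yt + unitVec (fine (P.L ^ P.K) M) μ)
                - minimiser (P.L ^ P.K) M (aK a P.L P.K) (((P.L ^ P.K : ℕ) : ℝ) ^ 2) m2 (Pi.single bt 1) yt))|
        ≤ Real.sqrt (((fprop38RateConst a a (lemma43Const a P.L P.K n) ((π ^ 2 / 4) ^ P.d) P.d γ (α + 1)
                  (2 * (P.d : ℝ) ^ α) (2 * (P.d : ℝ) ^ α * 2 ^ (1 - γ))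
                + fprop38PosConst a ((π ^ 2 / 4) ^ P.d) P.d γ (α + 1) (2 * (P.d : ℝ) ^ α) (6 * (P.d : ℝ) ^ (α + γ)))
              * ((P.L ^ P.K : ℕ) : ℝ) ^ (-γ)) * (2 * c))
          * Real.exp (-(δ / 2 * min (tdistT M (blockOf (P.L ^ P.K) M xt) bt) (tdistT M (blockOf (P.L ^ P.K) M yt) bt))) := by
  have hα1 : α < 1 := by linarith
  obtain ⟨δ, c, hδ, hc, H⟩ := holder_dkernel_decay_blocks dd L hd hLodd hL ha hm hα hα1
  refine ⟨δ, c, hδ, hc, ?_⟩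
  intro P hPd hPL hK _ n hn M _ hMK xt yt xt' yt' bt hxx hyy μ
  have hPd0 : 0 < P.d := by have := P.hd; omega
  have hPodd : Odd P.L := P.hL.1
  have hPL2 : 2 ≤ P.L := by have := P.hL.2; omega
  set m := min (tdistT M (blockOf (P.L ^ P.K) M xt) bt) (tdistT M (blockOf (P.L ^ P.K) M yt) bt) with hmdef
  have hA := H P hPd hPL hK M hMK (P.L ^ P.K) rfl xt yt bt μ
  have hMK' : ∀ ν, M ν = (⟨P.d, P.L, P.m, P.K + n, P.hd, P.hL⟩ : Params).sitesPerDir (P.K + n) := fun ν => by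
    rw [hMK ν]; exact (sitesPerDir_finerVolume P n).symm
  have hN : P.L ^ n * P.L ^ P.K = P.L ^ (P.K + n) := by rw [pow_add, mul_comm]
  have hB := H (⟨P.d, P.L, P.m, P.K + n, P.hd, P.hL⟩ : Params) hPd hPL (show 1 ≤ P.K + n by omega) M hMK'
    (P.L ^ n * P.L ^ P.K) hN xt' yt' bt μ
  rw [blockOf_over M xt xt' hxx, blockOf_over M yt yt' hyy] at hB
  push_cast at hA hB ⊢
  have hrate := king_prop38_holder_deriv_torus hPd0 hPodd hPL2 hK hn M ha hm hα.le hγ hαγ bt xt yt xt' yt' hxx hyy μ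
  push_cast at hrate
  have hε := (abs_nonneg _).trans hrate
  refine abs_le_sqrt_mul_exp_half hε hrate ?_
  calc _ ≤ _ + _ := abs_sub _ _
    _ ≤ c * Real.exp (-(δ * m)) + c * Real.exp (-(δ * m)) := add_le_add hB hA
    _ = 2 * c * Real.exp (-(δ * m)) := by ring

end Torus

end Literature.MathematicalPhysics.QuantumFieldTheory.King1986
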